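import Mathlib

/-!
# Formal partial derivatives on `MvPowerSeries` and the chain rule for `subst`

Folklore, missing from Mathlib (which has `PowerSeries.derivative` in one variable and
`MvPolynomial.pderiv`): the coefficientwise partial derivative
`pd i : MvPowerSeries σ R →ₗ[R] MvPowerSeries σ R`, `coeff e (pd i f) = (e i + 1) · coeff (e + eᵢ) f`,

* `pd_coe` — agrees with `MvPolynomial.pderiv` on polynomials; `pd_C`, `pd_X`, `pd_one`;
* `pd_mul` — the LEIBNIZ rule (reduced to polynomials through `MvPowerSeries.truncTotal`),
  `pd_pow_succ`;
* `pd_aeval` — the chain rule for polynomials evaluated at power series;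
* `coeff_subst_congr` — low-degree coefficients of `subst a f` only see low-degree coefficients
  of `f` (zero-constant `a`);
* `pd_subst` — the CHAIN RULE `∂ⱼ (f(a)) = ∑ᵢ (∂ᵢ f)(a) · ∂ⱼ aᵢ` for `MvPowerSeries.subst` of a
  zero-constant family `a : Fin n → MvPowerSeries τ k` (over a field, `τ` finite).

Written for the local weighted resolution game (route ResolutionOfSingularities/WeightedInvariant,
crux `LocalWeightedDrop`): singular loci and arcs are expressed through `pd`, and the chain rule
transports "the arc lies in the singular locus" through coordinate changes and blow-up charts.
-/

namespace Literature.RingTheory.MvPowerSeries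

open MvPowerSeries

variable {σ : Type*} {R : Type*} [CommSemiring R]


/-- Raw coefficient function of `∂/∂x_i`. [folklore] -/
noncomputable def pdFun (i : σ) (f : MvPowerSeries σ R) : MvPowerSeries σ R :=
  fun e => ((e i + 1 : ℕ) : R) * MvPowerSeries.coeff (e + Finsupp.single i 1) f

/-- `coeff_pdFun` (see the module docstring). [folklore] -/
theorem coeff_pdFun (i : σ) (f : MvPowerSeries σ R) (e : σ →₀ ℕ) :
    MvPowerSeries.coeff e (pdFun i f) = ((e i + 1 : ℕ) : R) * MvPowerSeries.coeff (e + Finsupp.single i 1) f :=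
  rfl

/-- The formal partial derivative `∂/∂x_i` on multivariate power series, coefficientwise:
`coeff e (pd i f) = (e i + 1) • coeff (e + single i 1) f`. [folklore] -/
noncomputable def pd (i : σ) : MvPowerSeries σ R →ₗ[R] MvPowerSeries σ R where
  toFun := pdFun i
  map_add' f g := by
    ext e; simp only [map_add, coeff_pdFun, mul_add]
  map_smul' c f := by
    ext e; simp only [map_smul, coeff_pdFun, smul_eq_mul, RingHom.id_apply]; ring

/-- `coeff_pd` (see the module docstring). [folklore] -/
theorem coeff_pd (i : σ) (f : MvPowerSeries σ R) (e : σ →₀ ℕ) :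
    MvPowerSeries.coeff e (pd i f) = ((e i + 1 : ℕ) : R) * MvPowerSeries.coeff (e + Finsupp.single i 1) f :=
  rfl

/-- On polynomials `pd` is `MvPolynomial.pderiv`. [folklore] -/
theorem pd_coe [DecidableEq σ] (i : σ) (P : MvPolynomial σ R) :
    pd i (P : MvPowerSeries σ R) = ((MvPolynomial.pderiv i P : MvPolynomial σ R) : MvPowerSeries σ R) := by
  ext e
  rw [coeff_pd, MvPolynomial.coeff_coe, MvPolynomial.coeff_coe]
  induction P using MvPolynomial.induction_on' with
  | monomial d a =>
    rw [MvPolynomial.pderiv_monomial, MvPolynomial.coeff_monomial, MvPolynomial.coeff_monomial]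
    by_cases h : d = e + Finsupp.single i 1
    · subst h
      simp
      ring
    · rw [if_neg h]
      by_cases h' : d - Finsupp.single i 1 = e
      · subst h'
        have hdi : d i = 0 := by
          by_contra hne
          apply h
          ext j
          by_cases hj : j = i
          · subst hj; simp; omega
          · simp [Ne.symm hj]
        simp [hdi]
      · rw [if_neg h', mul_zero]
  | add p q hp hq =>
    rw [MvPolynomial.coeff_add, map_add, MvPolynomial.coeff_add, mul_add, hp, hq]

/-- `pd_C` (see the module docstring). [folklore] -/
theorem pd_C (i : σ) (c : R) : pd i (MvPowerSeries.C c : MvPowerSeries σ R) = 0 := by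
  classical
  ext e
  rw [coeff_pd, MvPowerSeries.coeff_C, map_zero, if_neg, mul_zero]
  intro h
  have := congrArg (fun d => d i) h
  simp at this

/-- `pd_X` (see the module docstring). [folklore] -/
theorem pd_X [DecidableEq σ] (i j : σ) :
    pd i (MvPowerSeries.X j : MvPowerSeries σ R) = if j = i then 1 else 0 := by
  have := pd_coe (R := R) i (MvPolynomial.X j)
  rw [MvPolynomial.coe_X, MvPolynomial.pderiv_X] at this
  rw [this]
  split_ifs with h <;> simp [h]


/-! ### Leibniz rule (via truncation to polynomials) -/

/-- `coeff_pderiv_eq` (see the module docstring). [folklore] -/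
theorem coeff_pderiv_eq [DecidableEq σ] (i : σ) (Q : MvPolynomial σ R) (x : σ →₀ ℕ) :
    MvPolynomial.coeff x (MvPolynomial.pderiv i Q) =
      ((x i + 1 : ℕ) : R) * MvPolynomial.coeff (x + Finsupp.single i 1) Q := by
  have := congrArg (MvPowerSeries.coeff x) (pd_coe (R := R) i Q)
  rw [coeff_pd, MvPolynomial.coeff_coe, MvPolynomial.coeff_coe] at this
  exact this.symm

/-- `degree_add_single` (see the module docstring). [folklore] -/
theorem degree_add_single (x : σ →₀ ℕ) (i : σ) : (x + Finsupp.single i 1).degree = x.degree + 1 := by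
  rw [map_add, Finsupp.degree_single]

/-- `coeff_pderiv_truncTotal` (see the module docstring). [folklore] -/
theorem coeff_pderiv_truncTotal [Finite σ] [DecidableEq σ] (i : σ) (f : MvPowerSeries σ R) {D : ℕ} {x : σ →₀ ℕ}
    (hx : x.degree + 1 < D) :
    MvPolynomial.coeff x (MvPolynomial.pderiv i (MvPowerSeries.truncTotal D f)) =
      MvPolynomial.coeff x (MvPowerSeries.truncTotal D (pd i f)) := by
  rw [coeff_pderiv_eq, MvPowerSeries.coeff_truncTotal _ (by rw [degree_add_single]; exact hx),
    MvPowerSeries.coeff_truncTotal _ (by omega), coeff_pd]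

/-- Coefficients of a product only see low-degree coefficients of the first factor. [folklore] -/
theorem coeff_mul_congr_left {A A' B : MvPolynomial σ R} {e : σ →₀ ℕ}
    (h : ∀ x : σ →₀ ℕ, x.degree ≤ e.degree → MvPolynomial.coeff x A = MvPolynomial.coeff x A') :
    MvPolynomial.coeff e (A * B) = MvPolynomial.coeff e (A' * B) := by
  classical
  rw [MvPolynomial.coeff_mul, MvPolynomial.coeff_mul]
  refine Finset.sum_congr rfl fun x hx => ?_
  rw [Finset.HasAntidiagonal.mem_antidiagonal] at hx
  rw [h x.1 (by rw [← hx, map_add]; omega)]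

/-- `coeff_mul_congr_right` (see the module docstring). [folklore] -/
theorem coeff_mul_congr_right {A B B' : MvPolynomial σ R} {e : σ →₀ ℕ}
    (h : ∀ x : σ →₀ ℕ, x.degree ≤ e.degree → MvPolynomial.coeff x B = MvPolynomial.coeff x B') :
    MvPolynomial.coeff e (A * B) = MvPolynomial.coeff e (A * B') := by
  rw [mul_comm, coeff_mul_congr_left h, mul_comm]

/-- LEIBNIZ RULE for the formal partial derivative on power series. [folklore] -/
theorem pd_mul [Finite σ] [DecidableEq σ] (i : σ) (f g : MvPowerSeries σ R) :
    pd i (f * g) = pd i f * g + f * pd i g := by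
  ext e
  set D := e.degree + 2 with hD
  have hT : ∀ (u v : MvPowerSeries σ R), MvPowerSeries.coeff e (u * v) =
      MvPolynomial.coeff e (MvPowerSeries.truncTotal D u * MvPowerSeries.truncTotal D v) :=
    fun u v => (MvPowerSeries.coeff_truncTotal_mul_truncTotal_eq_coeff_mul (n := D) u v (by omega)).symm
  have h1 : MvPolynomial.coeff e (MvPolynomial.pderiv i (MvPowerSeries.truncTotal D f) *
      MvPowerSeries.truncTotal D g) = MvPowerSeries.coeff e (pd i f * g) := by
    rw [hT, coeff_mul_congr_left (A' := MvPowerSeries.truncTotal D (pd i f))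
      (fun x hx => coeff_pderiv_truncTotal (D := D) (x := x) i f (by omega))]
  have h2 : MvPolynomial.coeff e (MvPowerSeries.truncTotal D f *
      MvPolynomial.pderiv i (MvPowerSeries.truncTotal D g)) = MvPowerSeries.coeff e (f * pd i g) := by
    rw [hT, coeff_mul_congr_right (B' := MvPowerSeries.truncTotal D (pd i g))
      (fun x hx => coeff_pderiv_truncTotal (D := D) (x := x) i g (by omega))]
  rw [coeff_pd, ← MvPowerSeries.coeff_truncTotal_mul_truncTotal_eq_coeff_mul (n := D) _ _
      (by rw [degree_add_single]; omega),
    ← coeff_pderiv_eq, Derivation.leibniz, smul_eq_mul, smul_eq_mul, MvPolynomial.coeff_add,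
    map_add, ← h1, ← h2]
  ring

/-- `pd_one` (see the module docstring). [folklore] -/
theorem pd_one (i : σ) : pd i (1 : MvPowerSeries σ R) = 0 := by
  rw [← map_one (MvPowerSeries.C (σ := σ) (R := R))]; exact pd_C i 1

/-- `pd_pow_succ` (see the module docstring). [folklore] -/
theorem pd_pow_succ [Finite σ] [DecidableEq σ] (i : σ) (f : MvPowerSeries σ R) (m : ℕ) :
    pd i (f ^ (m + 1)) = ((m + 1 : ℕ) : MvPowerSeries σ R) * f ^ m * pd i f := by
  induction m with
  | zero => simp
  | succ m ih =>
    rw [pow_succ, pd_mul, ih]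
    push_cast
    ring


/-! ### Chain rule for `MvPowerSeries.subst` (zero-constant substitutions) -/

section ChainRule

variable {k : Type*} [Field k] {n : ℕ} {τ : Type*}

/-- CHAIN RULE on polynomials: `∂ⱼ (P(a)) = ∑ᵢ (∂ᵢP)(a) · ∂ⱼ aᵢ`. [folklore] -/
theorem pd_aeval [Fintype τ] [DecidableEq τ] (a : Fin n → MvPowerSeries τ k) (j : τ)
    (P : MvPolynomial (Fin n) k) :
    pd j (MvPolynomial.aeval a P) = ∑ i, MvPolynomial.aeval a (MvPolynomial.pderiv i P) * pd j (a i) := by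
  induction P using MvPolynomial.induction_on with
  | C c =>
    rw [MvPolynomial.aeval_C, MvPowerSeries.algebraMap_apply, Algebra.algebraMap_self, RingHom.id_apply,
      pd_C]
    simp
  | add p q hp hq => simp only [map_add, hp, hq, add_mul, Finset.sum_add_distrib]
  | mul_X p m ih =>
    rw [map_mul, MvPolynomial.aeval_X, pd_mul, ih]
    have hder : ∀ i, MvPolynomial.pderiv i (p * MvPolynomial.X m) =
        MvPolynomial.pderiv i p * MvPolynomial.X m + p * (if m = i then 1 else 0) := by
      intro i
      rw [Derivation.leibniz, MvPolynomial.pderiv_X, smul_eq_mul, smul_eq_mul]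
      split_ifs with h
      · simp [h]; ring
      · simp [h]; ring
    simp_rw [hder, map_add, map_mul, MvPolynomial.aeval_X, add_mul, Finset.sum_add_distrib]
    congr 1
    · rw [Finset.sum_mul]
      exact Finset.sum_congr rfl fun i _ => by ring
    · rw [Finset.sum_eq_single m]
      · simp
      · intro i _ him
        simp [Ne.symm him]
      · simp

/-- Products of zero-constant series have order at least the total exponent. [folklore] -/
theorem degree_le_order_finsuppProd {a : Fin n → MvPowerSeries τ k}
    (ha : ∀ i, MvPowerSeries.constantCoeff (a i) = 0) (d : Fin n →₀ ℕ) :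
    (d.degree : ℕ∞) ≤ (d.prod fun i m => a i ^ m).order := by
  rw [Finsupp.prod, Finsupp.degree_apply]
  refine le_trans ?_ (MvPowerSeries.le_order_prod _ _)
  push_cast
  exact Finset.sum_le_sum fun i _ => MvPowerSeries.le_order_pow_of_constantCoeff_eq_zero _ (ha i)

/-- Low-degree coefficients of `subst a f` only see low-degree coefficients of `f`. [folklore] -/
theorem coeff_subst_congr [Fintype τ] {a : Fin n → MvPowerSeries τ k}
    (ha : ∀ i, MvPowerSeries.constantCoeff (a i) = 0) {f f' : MvPowerSeries (Fin n) k} {D : ℕ}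
    (hff' : ∀ x : Fin n →₀ ℕ, x.degree ≤ D → MvPowerSeries.coeff x f = MvPowerSeries.coeff x f')
    {e : τ →₀ ℕ} (he : e.degree ≤ D) :
    MvPowerSeries.coeff e (MvPowerSeries.subst a f) = MvPowerSeries.coeff e (MvPowerSeries.subst a f') := by
  have has := MvPowerSeries.hasSubst_of_constantCoeff_zero ha
  rw [MvPowerSeries.coeff_subst has, MvPowerSeries.coeff_subst has]
  refine finsum_congr fun d => ?_
  by_cases hd : d.degree ≤ D
  · rw [hff' d hd]
  · have : MvPowerSeries.coeff e (d.prod fun i m => a i ^ m) = 0 := by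
      apply MvPowerSeries.coeff_of_lt_order
      exact lt_of_lt_of_le (by exact_mod_cast (by omega : e.degree < d.degree))
        (degree_le_order_finsuppProd ha d)
    rw [this, smul_zero, smul_zero]

/-- CHAIN RULE for substitution of zero-constant families into power series:
`∂ⱼ (f(a)) = ∑ᵢ (∂ᵢ f)(a) · ∂ⱼ aᵢ`. [folklore] -/
theorem pd_subst [Fintype τ] [DecidableEq τ] (a : Fin n → MvPowerSeries τ k)
    (ha : ∀ i, MvPowerSeries.constantCoeff (a i) = 0) (f : MvPowerSeries (Fin n) k) (j : τ) :
    pd j (MvPowerSeries.subst a f) = ∑ i, MvPowerSeries.subst a (pd i f) * pd j (a i) := by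
  classical
  ext e
  set M := e.degree + 2 with hM
  set F : MvPolynomial (Fin n) k := MvPowerSeries.truncTotal M f with hF
  have hfF : ∀ x : Fin n →₀ ℕ, x.degree ≤ e.degree + 1 →
      MvPowerSeries.coeff x f = MvPowerSeries.coeff x (F : MvPowerSeries (Fin n) k) := by
    intro x hx
    rw [MvPolynomial.coeff_coe, hF, MvPowerSeries.coeff_truncTotal _ (by omega)]
  have hpdF : ∀ (i : Fin n) (y : Fin n →₀ ℕ), y.degree ≤ e.degree →
      MvPowerSeries.coeff y (pd i f) =
        MvPowerSeries.coeff y ((MvPolynomial.pderiv i F : MvPolynomial (Fin n) k) : MvPowerSeries (Fin n) k) := by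
    intro i y hy
    rw [MvPolynomial.coeff_coe, hF, coeff_pderiv_truncTotal (D := M) (x := y) i f (by omega),
      MvPowerSeries.coeff_truncTotal _ (by omega)]
  -- LHS through `F`
  have hL : MvPowerSeries.coeff e (pd j (MvPowerSeries.subst a f)) =
      MvPowerSeries.coeff e (pd j (MvPolynomial.aeval a F)) := by
    rw [coeff_pd, coeff_pd, ← MvPowerSeries.subst_coe,
      coeff_subst_congr ha (D := e.degree + 1) hfF (by rw [degree_add_single])]
  -- RHS through `pderiv i F`
  have hR : ∀ i, MvPowerSeries.coeff e (MvPowerSeries.subst a (pd i f) * pd j (a i)) =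
      MvPowerSeries.coeff e (MvPolynomial.aeval a (MvPolynomial.pderiv i F) * pd j (a i)) := by
    intro i
    rw [MvPowerSeries.coeff_mul, MvPowerSeries.coeff_mul]
    refine Finset.sum_congr rfl fun x hx => ?_
    rw [Finset.HasAntidiagonal.mem_antidiagonal] at hx
    rw [← MvPowerSeries.subst_coe, coeff_subst_congr ha (D := e.degree) (hpdF i)
      (by rw [← hx, map_add]; omega)]
  rw [hL, pd_aeval, map_sum, map_sum]
  exact Finset.sum_congr rfl fun i _ => (hR i).symm

end ChainRule


end Literature.RingTheory.MvPowerSeries
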